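import Summits.ValiantsHypothesis.ValiantsHypothesis.Theorems.TameSensitivityQuantHrubesBase
import HarnessLib

/-!
# Route TameSensitivity — quantitative Hrubeš simulation, part B: products, variables, gates

Support file 2/3 for item `QuantHrubesPer` (stmt-ValiantsHypothesis-23473 / -23515), proved in
`Theorems/TameSensitivityQuantHrubes.lean`; continues `TameSensitivityQuantHrubesBase` (same
namespace, same local notations `Good[·]`, `Av[·,·]`, `RepB[·,·,·,·]`).

Contents: the bounded representation is stable under products (convolution of components; the
twin bound convolves by `homogeneousComponent_mul_eq_sum`) and holds for variables
(`x_j = (x_j + ½ Σ_{i≠j} x_i) - ½ Σ_{i≠j} x_i`, twin `x_j`); then operands, weighted-sum gates,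
product gates, one gate of fan-in `≤ 2` (`≤ 2(#σ + 2 + 8(d+1)²)` monotone gates), and the
induction along the gate list of a real fan-in-two circuit SIMULTANEOUSLY with its twin
`gates.map (Gate.map Real.nnabs)` (Hrubeš 2020, Lemma 22 (i), eq. (5), Lemma 23 (ii), proof of
Theorem 1).

Honest framing: bookkeeping for a provable-now SUPPORT item of two open routes; nothing here
bears on VP ≠ VNP itself.

## References

* [Hrubes2020] P. Hrubeš, *On ε-sensitive monotone computations*, Comput. Complexity 29 (2020)
  Art. 6, §4: Lemma 22, Lemma 23, Theorem 1.
* [JerrumSnir1982] M. Jerrum, M. Snir, J. ACM 29 (1982), §2.2.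
-/

noncomputable section

-- `Summit.ValiantsHypothesis.ValiantsHypothesis.…` is the tree's mandated layout (Sub = Summit).
set_option linter.dupNamespace false

namespace Summit.ValiantsHypothesis.ValiantsHypothesis.Theorems.TameSensitivityQuantHrubes

open MvPolynomial Literature.Computability.AlgebraicComplexity ArithCircuit
  Literature.Barriers.ValiantsHypothesis
open Summit.ValiantsHypothesis.ValiantsHypothesis.Theorems.CirculantFourierHrubes
open scoped NNReal

variable {σ : Type*}

/-- `Good[gs]` (local notation, not a definition): every gate of `gs` has fan-in `≤ 2` and is
plain. -/
local notation3 (prettyPrint := false) "Good[" gs "]" =>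
  ∀ g ∈ (gs : List (Gate ℝ≥0 _)), Gate.fanIn g ≤ 2 ∧ IsPlainGate g

/-- `Av[gs, a]` (local notation, not a definition): some operand referring only to gates of `gs`
evaluates to `a` against the values of `gs`. -/
local notation3 (prettyPrint := false) "Av[" gs ", " a "]" =>
  ∃ u : Operand ℝ≥0 _, Operand.RefsBelow (List.length gs) u ∧ Operand.eval (gateValues gs) u = a

/-- `RepB[gs, d, w, wt]` (local notation, not a definition): the real polynomial `w` is
*represented with bound `wt`* after the gates `gs` up to degree `d` — for every `k ≤ d` there are
available `P_k, Q_k ∈ ℝ≥0[x]` and `c_k ≥ 0` with `P_k - Q_k = w^{(k)}`, `P_k + Q_k = c_k L^k`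
(`L = Σ_i x_i`) and `c_k ≤ wt^{(k)}(1,…,1)` (`wt ∈ ℝ≥0[x]`, the abs-value twin of `w`). -/
local notation3 (prettyPrint := false) "RepB[" gs ", " d ", " w ", " wt "]" =>
  ∃ (P Q : ℕ → MvPolynomial _ ℝ≥0) (c : ℕ → ℝ≥0), ∀ k ≤ (d : ℕ),
    Av[gs, P k] ∧ Av[gs, Q k] ∧
    MvPolynomial.map NNReal.toRealHom (P k) - MvPolynomial.map NNReal.toRealHom (Q k) =
      MvPolynomial.homogeneousComponent k w ∧
    P k + Q k = c k • (∑ i, MvPolynomial.X i) ^ k ∧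
    c k ≤ MvPolynomial.eval (fun _ => (1 : ℝ≥0)) (MvPolynomial.homogeneousComponent k wt)


/-! ### The bounded representation, continued: products and variables -/

section Rep

variable [Fintype σ]

/-- Products of represented polynomials are represented after `≤ 8 (d + 1)²` new gates
(convolution of the components); twins multiply (Hrubeš 2020, Lemma 22 eq. (5), Lemma 23 (ii)). -/
theorem repB_mul {gs : List (Gate ℝ≥0 σ)} (hgs : Good[gs]) (d : ℕ) {w₁ w₂ : MvPolynomial σ ℝ}
    {wt₁ wt₂ : MvPolynomial σ ℝ≥0}
    (h₁ : RepB[gs, d, w₁, wt₁]) (h₂ : RepB[gs, d, w₂, wt₂]) :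
    ∃ gs' : List (Gate ℝ≥0 σ), Good[gs ++ gs'] ∧ gs'.length ≤ 8 * (d + 1) ^ 2 ∧
      RepB[gs ++ gs', d, w₁ * w₂, wt₁ * wt₂] := by
  obtain ⟨P₁, Q₁, c₁, h₁⟩ := h₁
  obtain ⟨P₂, Q₂, c₂, h₂⟩ := h₂
  have hAmono : ∀ gs gs' : List (Gate ℝ≥0 σ),
      (∀ k ≤ d, Av[gs, P₁ k] ∧ Av[gs, Q₁ k] ∧ Av[gs, P₂ k] ∧ Av[gs, Q₂ k]) →
      (∀ k ≤ d, Av[gs ++ gs', P₁ k] ∧ Av[gs ++ gs', Q₁ k] ∧ Av[gs ++ gs', P₂ k] ∧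
        Av[gs ++ gs', Q₂ k]) := fun gs gs' h k hk =>
    ⟨av_mono gs' (h k hk).1, av_mono gs' (h k hk).2.1, av_mono gs' (h k hk).2.2.1,
      av_mono gs' (h k hk).2.2.2⟩
  have hA : ∀ k ≤ d, Av[gs, P₁ k] ∧ Av[gs, Q₁ k] ∧ Av[gs, P₂ k] ∧ Av[gs, Q₂ k] :=
    fun k hk => ⟨(h₁ k hk).1, (h₁ k hk).2.1, (h₂ k hk).1, (h₂ k hk).2.1⟩
  -- one homogeneous slice of `P` resp. `Q` costs `≤ 4 (d + 1)` gates
  have slice : ∀ (swap : Bool) (gs' : List (Gate ℝ≥0 σ)), Good[gs'] →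
      (∀ k ≤ d, Av[gs', P₁ k] ∧ Av[gs', Q₁ k] ∧ Av[gs', P₂ k] ∧ Av[gs', Q₂ k]) → ∀ k ≤ d,
      ∃ gs'' : List (Gate ℝ≥0 σ), Good[gs' ++ gs''] ∧ gs''.length ≤ 4 * (d + 1) ∧
        Av[gs' ++ gs'', ∑ a ∈ Finset.range (k + 1),
          if swap then P₁ a * Q₂ (k - a) + Q₁ a * P₂ (k - a)
          else P₁ a * P₂ (k - a) + Q₁ a * Q₂ (k - a)] := by
    intro swap gs' hg' hA' k hk
    obtain ⟨gsa, hga, hla, -, hsa⟩ := ext_family hg' k 3 _ hAmono hA'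
      (fun a => if swap then P₁ a * Q₂ (k - a) + Q₁ a * P₂ (k - a)
        else P₁ a * P₂ (k - a) + Q₁ a * Q₂ (k - a))
      (fun gs'' hg'' hA'' a ha => by
        cases swap
        · exact ext_mul_add hg'' (hA'' a (by omega)).1 (hA'' (k - a) (by omega)).2.2.1
            (hA'' a (by omega)).2.1 (hA'' (k - a) (by omega)).2.2.2
        · exact ext_mul_add hg'' (hA'' a (by omega)).1 (hA'' (k - a) (by omega)).2.2.2
            (hA'' a (by omega)).2.1 (hA'' (k - a) (by omega)).2.2.1)
    obtain ⟨gsb, hgb, hlb, hsb⟩ := ext_sum (Finset.range (k + 1))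
      (fun a => if swap then P₁ a * Q₂ (k - a) + Q₁ a * P₂ (k - a)
        else P₁ a * P₂ (k - a) + Q₁ a * Q₂ (k - a)) (gs' ++ gsa) hga
      (fun a ha => hsa a (by have := Finset.mem_range.mp ha; omega))
    refine ⟨gsa ++ gsb, by simpa only [List.append_assoc] using hgb, ?_, by
      simpa only [List.append_assoc] using hsb⟩
    rw [List.length_append, Finset.card_range] at *
    have : gsb.length ≤ k + 1 := by simpa using hlb
    nlinarith
  obtain ⟨gs₁, hg₁, hl₁, hA₁, hs₁⟩ := ext_family hgs d (4 * (d + 1)) _ hAmono hA _ (slice false)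
  obtain ⟨gs₂, hg₂, hl₂, -, hs₂⟩ := ext_family hg₁ d (4 * (d + 1)) _ hAmono hA₁ _ (slice true)
  simp only [Bool.false_eq_true, ↓reduceIte] at hs₁
  simp only [↓reduceIte] at hs₂
  refine ⟨gs₁ ++ gs₂, by simpa only [List.append_assoc] using hg₂, ?_,
    fun k => ∑ a ∈ Finset.range (k + 1), (P₁ a * P₂ (k - a) + Q₁ a * Q₂ (k - a)),
    fun k => ∑ a ∈ Finset.range (k + 1), (P₁ a * Q₂ (k - a) + Q₁ a * P₂ (k - a)),
    fun k => ∑ a ∈ Finset.range (k + 1), c₁ a * c₂ (k - a), fun k hk => ⟨?_, ?_, ?_, ?_, ?_⟩⟩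
  · rw [List.length_append]; nlinarith
  · rw [← List.append_assoc]; exact av_mono gs₂ (hs₁ k hk)
  · rw [← List.append_assoc]; exact hs₂ k hk
  · rw [map_sum, map_sum, ← Finset.sum_sub_distrib, homogeneousComponent_mul_eq_sum]
    refine Finset.sum_congr rfl fun a ha => ?_
    have ha' : a ≤ k := by have := Finset.mem_range.mp ha; omega
    obtain ⟨-, -, e₁, -, -⟩ := h₁ a (by omega)
    obtain ⟨-, -, e₂, -, -⟩ := h₂ (k - a) (by omega)
    rw [← e₁, ← e₂]
    simp only [map_add, map_mul]
    ring
  · rw [← Finset.sum_add_distrib, Finset.sum_smul]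
    refine Finset.sum_congr rfl fun a ha => ?_
    have ha' : a ≤ k := by have := Finset.mem_range.mp ha; omega
    obtain ⟨-, -, -, f₁, -⟩ := h₁ a (by omega)
    obtain ⟨-, -, -, f₂, -⟩ := h₂ (k - a) (by omega)
    calc P₁ a * P₂ (k - a) + Q₁ a * Q₂ (k - a) + (P₁ a * Q₂ (k - a) + Q₁ a * P₂ (k - a))
        = (P₁ a + Q₁ a) * (P₂ (k - a) + Q₂ (k - a)) := by ring
      _ = _ := by rw [f₁, f₂, smul_mul_smul_comm, ← pow_add, Nat.add_sub_of_le ha']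
  · rw [ev_hc_mul]
    refine Finset.sum_le_sum fun a ha => ?_
    have ha' : a ≤ k := by have := Finset.mem_range.mp ha; omega
    obtain ⟨-, -, -, -, b₁⟩ := h₁ a (by omega)
    obtain ⟨-, -, -, -, b₂⟩ := h₂ (k - a) (by omega)
    exact mul_le_mul b₁ b₂ (_root_.zero_le) (_root_.zero_le)

variable [DecidableEq σ]

/-- Variables are represented after `≤ #σ + 2` new gates
(`x_j = (x_j + ½ Σ_{i ≠ j} x_i) - ½ Σ_{i ≠ j} x_i`, Hrubeš 2020, Lemma 22 (i)); twin `x_j`. -/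
theorem repB_X {gs : List (Gate ℝ≥0 σ)} (hgs : Good[gs]) (d : ℕ) (j : σ) :
    ∃ gs' : List (Gate ℝ≥0 σ), Good[gs ++ gs'] ∧ gs'.length ≤ Fintype.card σ + 2 ∧
      RepB[gs ++ gs', d, (X j : MvPolynomial σ ℝ), (X j : MvPolynomial σ ℝ≥0)] := by
  obtain ⟨gs₁, hg₁, hl₁, hS⟩ := ext_sum (Finset.univ.erase j)
    (fun i => (X i : MvPolynomial σ ℝ≥0)) gs hgs (fun i _ => av_X gs i)
  obtain ⟨gs₂, hg₂, hl₂, hH⟩ := ext_mul hg₁ (av_C _ (1 / 2)) hS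
  obtain ⟨gs₃, hg₃, hl₃, hP⟩ := ext_add hg₂ (av_X _ j) hH
  refine ⟨gs₁ ++ gs₂ ++ gs₃, by simpa only [List.append_assoc] using hg₃, ?_, ?_⟩
  · simp only [List.length_append]
    have : (Finset.univ.erase j).card ≤ Fintype.card σ :=
      (Finset.card_erase_le).trans (Finset.card_univ (α := σ)).le
    omega
  · refine ⟨fun k => if k = 1 then X j + C (1 / 2) * ∑ i ∈ Finset.univ.erase j, X i else 0,
      fun k => if k = 1 then C (1 / 2) * ∑ i ∈ Finset.univ.erase j, X i else 0,
      fun k => if k = 1 then 1 else 0, fun k _ => ?_⟩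
    have hX : homogeneousComponent k (X j : MvPolynomial σ ℝ) = if k = 1 then X j else 0 :=
      homogeneousComponent_of_mem (isHomogeneous_X ℝ j)
    by_cases hk : k = 1
    · subst hk
      simp only [↓reduceIte]
      refine ⟨by simpa only [List.append_assoc] using hP,
        by simpa only [List.append_assoc] using av_mono gs₃ hH, ?_, ?_, ?_⟩
      · rw [hX, if_pos rfl, map_add, map_X, add_sub_cancel_right]
      · rw [pow_one, one_smul, add_assoc, ← add_mul, ← C_add, add_halves, C_1, one_mul,
          Finset.add_sum_erase _ _ (Finset.mem_univ j)]
      · rw [ev_hc_X, if_pos rfl]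
    · simp only [hk, ↓reduceIte]
      refine ⟨av_zero _, av_zero _, ?_, by simp, _root_.zero_le⟩
      rw [hX, if_neg hk]; simp

/-! ### Simulating a real fan-in-two circuit together with its twin -/

/-- The value of any operand of the simulated real circuit is represented after `≤ #σ + 2` new
gates, with twin the value of the twin operand, provided every earlier gate value is represented
with twin the corresponding twin gate value. -/
theorem repB_operand {gs : List (Gate ℝ≥0 σ)} (hgs : Good[gs]) (d : ℕ)
    (vals : List (MvPolynomial σ ℝ)) (tvals : List (MvPolynomial σ ℝ≥0))
    (hvals : ∀ j : ℕ, RepB[gs, d, vals.getD j 0, tvals.getD j 0]) (u : Operand ℝ σ) :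
    ∃ gs' : List (Gate ℝ≥0 σ), Good[gs ++ gs'] ∧ gs'.length ≤ Fintype.card σ + 2 ∧
      RepB[gs ++ gs', d, u.eval vals, (u.map Real.nnabs).eval tvals] := by
  cases u with
  | var j =>
    have e₁ : (Operand.var j : Operand ℝ σ).eval vals = X j := rfl
    have e₂ : ((Operand.var j : Operand ℝ σ).map Real.nnabs).eval tvals = X j := rfl
    rw [e₁, e₂]
    exact repB_X hgs d j
  | const γ =>
    have e₁ : (Operand.const γ : Operand ℝ σ).eval vals = C γ := rfl
    have e₂ : ((Operand.const γ : Operand ℝ σ).map Real.nnabs).eval tvals = C (Real.nnabs γ) :=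
      rfl
    refine ⟨[], by simpa using hgs, by simp, ?_⟩
    rw [List.append_nil, e₁, e₂]
    exact repB_C gs d γ
  | gate j =>
    have e₁ : (Operand.gate j : Operand ℝ σ).eval vals = vals.getD j 0 := rfl
    have e₂ : ((Operand.gate j : Operand ℝ σ).map Real.nnabs).eval tvals = tvals.getD j 0 := rfl
    refine ⟨[], by simpa using hgs, by simp, ?_⟩
    rw [List.append_nil, e₁, e₂]
    exact hvals j

/-- A weighted-sum gate of the simulated circuit, with its twin. -/
theorem repB_sumGate {gs : List (Gate ℝ≥0 σ)} (hgs : Good[gs]) (d : ℕ)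
    (vals : List (MvPolynomial σ ℝ)) (tvals : List (MvPolynomial σ ℝ≥0))
    (hvals : ∀ j : ℕ, RepB[gs, d, vals.getD j 0, tvals.getD j 0])
    (args : List (ℝ × Operand ℝ σ)) :
    ∃ gs' : List (Gate ℝ≥0 σ), Good[gs ++ gs'] ∧
      gs'.length ≤ args.length * (Fintype.card σ + 2 + 8 * (d + 1)) ∧
      RepB[gs ++ gs', d, (args.map fun a => a.1 • a.2.eval vals).sum,
        (args.map fun a => Real.nnabs a.1 • (a.2.map Real.nnabs).eval tvals).sum] := by
  induction args with
  | nil => exact ⟨[], by simpa using hgs, by simp, by simpa using repB_zero gs d 0⟩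
  | cons a args ih =>
    obtain ⟨gs₁, hg₁, hl₁, hr₁⟩ := ih
    obtain ⟨gs₂, hg₂, hl₂, hr₂⟩ :=
      repB_operand hg₁ d vals tvals (fun j => repB_mono gs₁ (hvals j)) a.2
    obtain ⟨gs₃, hg₃, hl₃, hr₃⟩ := repB_smul hg₂ d a.1 hr₂
    have hr₁' : RepB[gs ++ gs₁ ++ gs₂ ++ gs₃, d, (args.map fun a => a.1 • a.2.eval vals).sum,
        (args.map fun a => Real.nnabs a.1 • (a.2.map Real.nnabs).eval tvals).sum] := by
      simpa only [List.append_assoc] using repB_mono (gs₂ ++ gs₃) hr₁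
    obtain ⟨gs₄, hg₄, hl₄, hr₄⟩ := repB_add hg₃ d hr₃ hr₁'
    refine ⟨gs₁ ++ gs₂ ++ gs₃ ++ gs₄, by simpa only [List.append_assoc] using hg₄, ?_, ?_⟩
    · simp only [List.length_append, List.length_cons]
      nlinarith
    · rw [List.map_cons, List.sum_cons, List.map_cons, List.sum_cons]
      simpa only [List.append_assoc] using hr₄

/-- A product gate of the simulated circuit, with its twin. -/
theorem repB_prodGate {gs : List (Gate ℝ≥0 σ)} (hgs : Good[gs]) (d : ℕ)
    (vals : List (MvPolynomial σ ℝ)) (tvals : List (MvPolynomial σ ℝ≥0))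
    (hvals : ∀ j : ℕ, RepB[gs, d, vals.getD j 0, tvals.getD j 0])
    (args : List (Operand ℝ σ)) :
    ∃ gs' : List (Gate ℝ≥0 σ), Good[gs ++ gs'] ∧
      gs'.length ≤ args.length * (Fintype.card σ + 2 + 8 * (d + 1) ^ 2) ∧
      RepB[gs ++ gs', d, (args.map fun u => u.eval vals).prod,
        (args.map fun u => (u.map Real.nnabs).eval tvals).prod] := by
  induction args with
  | nil => exact ⟨[], by simpa using hgs, by simp, by simpa using repB_C gs d 1⟩
  | cons u args ih =>
    obtain ⟨gs₁, hg₁, hl₁, hr₁⟩ := ih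
    obtain ⟨gs₂, hg₂, hl₂, hr₂⟩ :=
      repB_operand hg₁ d vals tvals (fun j => repB_mono gs₁ (hvals j)) u
    have hr₁' : RepB[gs ++ gs₁ ++ gs₂, d, (args.map fun u => u.eval vals).prod,
        (args.map fun u => (u.map Real.nnabs).eval tvals).prod] := by
      simpa only [List.append_assoc] using repB_mono gs₂ hr₁
    obtain ⟨gs₃, hg₃, hl₃, hr₃⟩ := repB_mul hg₂ d hr₂ hr₁'
    refine ⟨gs₁ ++ gs₂ ++ gs₃, by simpa only [List.append_assoc] using hg₃, ?_, ?_⟩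
    · simp only [List.length_append, List.length_cons]
      nlinarith
    · rw [List.map_cons, List.prod_cons, List.map_cons, List.prod_cons]
      simpa only [List.append_assoc] using hr₃

/-- One gate of fan-in `≤ 2` of the simulated circuit costs `≤ 2 (#σ + 2 + 8 (d + 1)²)` gates;
the twin is the value of the twin gate. -/
theorem repB_gate {gs : List (Gate ℝ≥0 σ)} (hgs : Good[gs]) (d : ℕ)
    (vals : List (MvPolynomial σ ℝ)) (tvals : List (MvPolynomial σ ℝ≥0))
    (hvals : ∀ j : ℕ, RepB[gs, d, vals.getD j 0, tvals.getD j 0])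
    (g : Gate ℝ σ) (hg : g.fanIn ≤ 2) :
    ∃ gs' : List (Gate ℝ≥0 σ), Good[gs ++ gs'] ∧
      gs'.length ≤ 2 * (Fintype.card σ + 2 + 8 * (d + 1) ^ 2) ∧
      RepB[gs ++ gs', d, g.eval vals, (g.map Real.nnabs).eval tvals] := by
  have hd : d + 1 ≤ (d + 1) ^ 2 := Nat.le_self_pow two_ne_zero _
  cases g with
  | sum args =>
    obtain ⟨gs', h1, h2, h3⟩ := repB_sumGate hgs d vals tvals hvals args
    have hlen : args.length ≤ 2 := by simpa [Gate.fanIn, Gate.args] using hg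
    have hv : (Gate.sum args).eval vals = (args.map fun a => a.1 • a.2.eval vals).sum := rfl
    have ht : ((Gate.sum args).map Real.nnabs).eval tvals =
        (args.map fun a => Real.nnabs a.1 • (a.2.map Real.nnabs).eval tvals).sum := by
      simp [Gate.map, Gate.eval, List.map_map, Function.comp_def]
    refine ⟨gs', h1, ?_, by rw [hv, ht]; exact h3⟩
    calc gs'.length ≤ args.length * (Fintype.card σ + 2 + 8 * (d + 1)) := h2
      _ ≤ 2 * (Fintype.card σ + 2 + 8 * (d + 1) ^ 2) := by
        calc args.length * (Fintype.card σ + 2 + 8 * (d + 1))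
            ≤ 2 * (Fintype.card σ + 2 + 8 * (d + 1)) := Nat.mul_le_mul_right _ hlen
          _ ≤ 2 * (Fintype.card σ + 2 + 8 * (d + 1) ^ 2) := by
            apply Nat.mul_le_mul_left; omega
  | prod args =>
    obtain ⟨gs', h1, h2, h3⟩ := repB_prodGate hgs d vals tvals hvals args
    have hlen : args.length ≤ 2 := by simpa [Gate.fanIn, Gate.args] using hg
    have hv : (Gate.prod args).eval vals = (args.map fun u => u.eval vals).prod := rfl
    have ht : ((Gate.prod args).map Real.nnabs).eval tvals =
        (args.map fun u => (u.map Real.nnabs).eval tvals).prod := by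
      simp [Gate.map, Gate.eval, List.map_map, Function.comp_def]
    refine ⟨gs', h1, ?_, by rw [hv, ht]; exact h3⟩
    exact h2.trans (Nat.mul_le_mul_right _ hlen)

/-- **Simulation of a real fan-in-two circuit with the twin bound**: every gate value of a gate
list `gs₀` over `ℝ` (indexed by gate number, junk `0` out of range) is represented, with twin the
corresponding gate value of `gs₀.map (Gate.map nnabs)`, by a plain monotone gate list over `ℝ≥0`
of length `≤ |gs₀| · 2 (#σ + 2 + 8 (d + 1)²)`. -/
theorem repB_gates (d : ℕ) (gs₀ : List (Gate ℝ σ)) (h : ∀ g ∈ gs₀, g.fanIn ≤ 2) :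
    ∃ gs : List (Gate ℝ≥0 σ), Good[gs] ∧
      gs.length ≤ gs₀.length * (2 * (Fintype.card σ + 2 + 8 * (d + 1) ^ 2)) ∧
      ∀ j : ℕ, RepB[gs, d, (gateValues gs₀).getD j 0,
        (gateValues (gs₀.map (Gate.map Real.nnabs))).getD j 0] := by
  induction gs₀ using List.reverseRecOn with
  | nil =>
    refine ⟨[], good_nil, by simp, fun j => ?_⟩
    have h1 : (gateValues ([] : List (Gate ℝ σ))).getD j 0 = 0 := by simp [gateValues]
    have h2 : (gateValues (([] : List (Gate ℝ σ)).map (Gate.map Real.nnabs))).getD j 0 = 0 := by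
      simp [gateValues]
    rw [h1, h2]
    exact repB_zero [] d 0
  | append_singleton gs₀ g ih =>
    obtain ⟨gs, hg, hl, hr⟩ := ih (fun g' hg' => h g' (List.mem_append_left _ hg'))
    obtain ⟨gs', hg', hl', hr'⟩ := repB_gate hg d _ _ hr g (h g (by simp))
    refine ⟨gs ++ gs', hg', ?_, fun j => ?_⟩
    · simp only [List.length_append, List.length_singleton]
      nlinarith
    · have hlv : (gateValues gs₀).length = gs₀.length := gateValues_length gs₀
      have hlt : (gateValues (gs₀.map (Gate.map Real.nnabs))).length = gs₀.length := by
        rw [gateValues_length, List.length_map]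
      rw [List.map_append, List.map_singleton, gateValues_append_singleton,
        gateValues_append_singleton]
      rcases Nat.lt_trichotomy j gs₀.length with hj | hj | hj
      · rw [getD_concat_of_lt _ _ _ (by omega), getD_concat_of_lt _ _ _ (by omega)]
        exact repB_mono gs' (hr j)
      · have hj₁ : j = (gateValues gs₀).length := by omega
        have hj₂ : j = (gateValues (gs₀.map (Gate.map Real.nnabs))).length := by omega
        conv in (List.getD _ j 0) =>
          rw [hj₁, List.getD_eq_getElem?_getD, List.getElem?_concat_length, Option.getD_some]
        conv in (List.getD _ j 0) =>
          rw [hj₂, List.getD_eq_getElem?_getD, List.getElem?_concat_length, Option.getD_some]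
        exact hr'
      · rw [getD_concat_of_gt _ _ _ (by omega), getD_concat_of_gt _ _ _ (by omega)]
        exact repB_zero _ d 0

end Rep

end Summit.ValiantsHypothesis.ValiantsHypothesis.Theorems.TameSensitivityQuantHrubes

end
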